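import Summits.QuantumFields.BalabanUV.T4Continuum.Support.NE9RelativeChartPlaquette
import Summits.QuantumFields.BalabanUV.T4Continuum.Support.SubstrateTransporterSpecies

/-!
# NE9RelativeChartPlaquetteWitness — companion of `NE9RelativeChartPlaquette` (D-8-abs from the NE9 owner's side): §5 the quadratic
# member of the relative-chart plaquette bound is SHARP (a flat, covariantly constant, non-abelian coordinate violates clause (iii) at
# second order — «relative ≠ absolute» in the kernel), §6 the bound instantiated on the substrate's chart of record `expChart ∕ expChartInv`
# with the unitarity side conditions DISCHARGED (cell `pub-balaban`, T4-DAG §2 node U3 ∕ §6 NE9; BINDER row NE9 OWNER lineage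
# `b2b-balaban-t4-ne9-p1`, generation 35; substrate-typer ruling (λ8) «D-8-abs», journal `CLAIMS.log` l.17442)
# v1.0.1 (generation 36, DOCFIX-LOW riding with cross-read C-ne9leaf03g22-1, journal l.18047): print's regime after (3.37) p. 277 re-read on the
# ×2 RENDER — «B₃²O(1)Mα₀ < 1∕2α₁» (v1 carried `B₃`); declarations unchanged.

HONEST FRAMING (T4-DAG PAGE 1).  Rung (B)+1 of the FINITE-VOLUME T⁴ programme — NOT infinite volume, NOT a mass gap, NOT the Clay
problem.  NE9 (`T4OutputRate.NE9` ∧ `FadingMemory`) is a cell NEW ESTIMATE, NOT PRINTED in [I] = [Balaban1987RG1] (CMP **109**),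
[II] = [Balaban1988RG2Cluster] (CMP **116**), and NOT PROVED for Bałaban's E^{(j)} («NE9 ⇐ the named binders»; 0∕18 leaves instantiated
on Bałaban's objects; spine PROVED 0∕9).  HONEST DEPENDENCY (cell line, verbatim): continuum YM on T⁴ ⇐ BetaPertH ∧ nine spine estimates
(0/9 proved); BetaPertH ⇐ (D1) ∧ (D4) ∧ CAP+tail; G-an2-4 gates asym, D1 and NE2/3/4.  `FlowStep.BetaPertH`, (B), (B^μ) do not occur.
One exact 2×2 computation and one instantiation BY NAME; no object of the series is asserted to satisfy anything (ABSOLUTE RULE).  0 sorry.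

* §5 **`flat_commutator_witness`** — AMPLITUDE ALONE DOES NOT GIVE CLAUSE (iii): on `M₂(ℂ)` (𝐠^c-valued, as [I] (1.13) p. 262 allows)
  with the FLAT background `U = V = 1` (`plaqBg = 1`, curvature `ε = 0`) and the covariantly CONSTANT coordinate `C = (tE₁₂, tE₂₁, tE₁₂,
  tE₂₁)` (both `covDiff = 0`), the chart-point plaquette `e^{tE₁₂}e^{tE₂₁}e^{−tE₁₂}e^{−tE₂₁}` equals `((1 + t² + t⁴, −t³), (t³, 1 − t²))`
  (`commutator_plaquette`; the exponentials of square-zero elements stop, `exp_eq_one_add_of_mul_self_eq_zero`), so `(holRel − 1)₂₂ = −t²`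
  EXACTLY.  Hence the quadratic member `16α₁²` of `NE9RelativeChartPlaquette.CondIIIBudget` cannot be dropped: an amplitude-only relative
  ball of radius `ξα₁` around a configuration satisfying (1.11) contains points whose plaquettes deviate by `≍ ξ²α₁²`, incompatible with
  (1.14)'s `α₀ξ²` unless `α₁² ≲ α₀` — false in print's regime «B₃²O(1)Mα₀ < 1∕2α₁» ([I] p. 277) for small `α₀`.  This is the kernel content
  of the typer's «the substrate's chart balls are RELATIVE …, print's (3.53) radii are ABSOLUTE»: NO amplitude-only chart ball of print's
  radius lies in `U^c_j(X, α₀, α₁)`; the relative set that does is the WEIGHTED one (amplitude AND covariant differences AND the budget).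
* §6 **`holRel_eq_expChart`**, **`norm_chartPlaquette_sub_one_le`** — ON THE SUBSTRATE'S OBJECTS (norm of record `Matrix.Norms.L2Operator`,
  typer Q-S13): the plaquette word of four chart bond values `expChart R⁰ A ∕ expChartInv R⁰ A` IS `holRel` of the bond data, and for
  UNITARY-valued `R⁰` the side conditions of `norm_holRel_sub_one_le` (`‖·‖ ≤ 1`, two-sided inverses) are DISCHARGED
  (`CStarRing.norm_of_mem_unitary`, `Matrix.nonsing_inv_mul`), leaving `‖… − 1‖ ≤ ε + 2δ + 4aε + (e^{4a} − 1 − 4a)` with `ε` the reference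
  plaquette's deviation, `a` the amplitude and `δ` the two covariant differences at those bonds.
DISGUISE TEST: an exact matrix identity and a by-name instantiation; no functional of the series; not NE9, not (B).

References (TYPES ∕ loci only): [Balaban1987RG1] T. Bałaban, CMP **109** (1987) 249–301: (1.11)–(1.14) p. 262, p. 277, (3.43) p. 278,
(3.53) p. 280; [Balaban1985BackgroundPropagators] T. Bałaban, CMP **99** (1985) 389–434, Sect. B pp. 399–400 (KIND of the chart).
Summits-side NEW work (LEAN PLACEMENT RULE); imports `NE9RelativeChartPlaquette` (this generation) and `SubstrateTransporterSpecies` (the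
chart, BY NAME); modifies nothing.  Value = the sharpness witness and the substrate-side instantiation of the D-8-abs inequality; NOT
summit progress.
-/

noncomputable section

namespace Summit.QuantumFields.BalabanUV.T4Continuum.NE9RelativeChartPlaquetteWitness

open NormedSpace
open Summit.QuantumFields.BalabanUV.T4Continuum.NE9RelativeChartPlaquette

section Flat

variable {𝔸 : Type*} [Ring 𝔸] [TopologicalSpace 𝔸] [IsTopologicalRing 𝔸]

omit [TopologicalSpace 𝔸] [IsTopologicalRing 𝔸] in
/-- [folklore] At the flat background both covariant differences are plain differences and the background plaquette is `1`. -/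
theorem covDiff_one_one (C : Fin 4 → 𝔸) :
    covDiff₁ 1 1 C = C 2 - C 0 ∧ covDiff₂ 1 1 C = C 1 - C 3 ∧ plaqBg (1 : Fin 4 → 𝔸) 1 = 1 := by
  simp [covDiff₁, covDiff₂, plaqBg]

/-- [folklore] At the FLAT background (`U = V = 1`) the chart-point plaquette is the pure-exponential plaquette of `T4SegmentCurvature`:
`holRel 1 1 C = e^{C₁}e^{C₂}e^{−C₃}e^{−C₄}`. -/
theorem holRel_one_one (C : Fin 4 → 𝔸) :
    holRel 1 1 C = exp (C 0) * exp (C 1) * exp (-(C 2)) * exp (-(C 3)) := by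
  simp [holRel]

end Flat

/-! ## §5 The quadratic member is sharp: a flat, covariantly constant, non-abelian coordinate violates (iii) at second order -/

section Witness

open Matrix

/-- [folklore] In a topological `ℚ`-algebra the exponential of a square-zero element is `1 + x` (the series stops). -/
theorem exp_eq_one_add_of_mul_self_eq_zero {𝔸 : Type*} [Ring 𝔸] [Algebra ℚ 𝔸] [TopologicalSpace 𝔸] [IsTopologicalRing 𝔸]
    [T2Space 𝔸] {x : 𝔸} (hx : x * x = 0) : exp x = 1 + x := by
  rw [exp_eq_tsum_rat]
  have hvan : ∀ n ∉ Finset.range 2, ((Nat.factorial n : ℚ)⁻¹) • x ^ n = 0 := by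
    intro n hn
    have h2 : 2 ≤ n := by simp only [Finset.mem_range, not_lt] at hn; exact hn
    rw [pow_eq_zero_of_le h2 (by rw [pow_two, hx]), smul_zero]
  show (∑' n : ℕ, ((Nat.factorial n : ℚ)⁻¹) • x ^ n) = 1 + x
  rw [tsum_eq_sum hvan, Finset.sum_range_succ, Finset.sum_range_succ, Finset.sum_range_zero]
  simp

/-- [folklore] The upper nilpotent `tE₁₂ ∈ 𝔰𝔩₂(ℂ) ⊂ 𝐠^c`. -/
def nilUp (t : ℂ) : Matrix (Fin 2) (Fin 2) ℂ := !![0, t; 0, 0]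

/-- [folklore] The lower nilpotent `tE₂₁ ∈ 𝔰𝔩₂(ℂ) ⊂ 𝐠^c`. -/
def nilDown (t : ℂ) : Matrix (Fin 2) (Fin 2) ℂ := !![0, 0; t, 0]

/-- [folklore] `exp (tE₁₂) = 1 + tE₁₂` written out. -/
theorem exp_nilUp (t : ℂ) : exp (nilUp t) = !![1, t; 0, 1] := by
  have h : nilUp t * nilUp t = 0 := by
    ext i j; fin_cases i <;> fin_cases j <;> simp [nilUp, Matrix.mul_apply, Fin.sum_univ_two]
  rw [exp_eq_one_add_of_mul_self_eq_zero h]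
  ext i j; fin_cases i <;> fin_cases j <;> simp [nilUp]

/-- [folklore] `exp (tE₂₁) = 1 + tE₂₁` written out. -/
theorem exp_nilDown (t : ℂ) : exp (nilDown t) = !![1, 0; t, 1] := by
  have h : nilDown t * nilDown t = 0 := by
    ext i j; fin_cases i <;> fin_cases j <;> simp [nilDown, Matrix.mul_apply, Fin.sum_univ_two]
  rw [exp_eq_one_add_of_mul_self_eq_zero h]
  ext i j; fin_cases i <;> fin_cases j <;> simp [nilDown]

/-- [folklore] `exp (−tE₁₂) = 1 − tE₁₂` written out. -/
theorem exp_neg_nilUp (t : ℂ) : exp (-nilUp t) = !![1, -t; 0, 1] := by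
  have h : -nilUp t = nilUp (-t) := by ext i j; fin_cases i <;> fin_cases j <;> simp [nilUp]
  rw [h, exp_nilUp]

/-- [folklore] `exp (−tE₂₁) = 1 − tE₂₁` written out. -/
theorem exp_neg_nilDown (t : ℂ) : exp (-nilDown t) = !![1, 0; -t, 1] := by
  have h : -nilDown t = nilDown (-t) := by ext i j; fin_cases i <;> fin_cases j <;> simp [nilDown]
  rw [h, exp_nilDown]

/-- [folklore] THE COMMUTATOR PLAQUETTE, written out: `e^{tE₁₂}e^{tE₂₁}e^{−tE₁₂}e^{−tE₂₁} = ((1 + t² + t⁴, −t³), (t³, 1 − t²))`. -/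
theorem commutator_plaquette (t : ℂ) :
    exp (nilUp t) * exp (nilDown t) * exp (-nilUp t) * exp (-nilDown t) = !![1 + t ^ 2 + t ^ 4, -t ^ 3; t ^ 3, 1 - t ^ 2] := by
  rw [exp_nilUp, exp_nilDown, exp_neg_nilUp, exp_neg_nilDown]
  simp only [Matrix.mul_fin_two]
  ext i j; fin_cases i <;> fin_cases j <;> simp <;> ring

/-- **THE FLAT COMMUTATOR WITNESS — AMPLITUDE ALONE DOES NOT GIVE CLAUSE (iii).**  On `M₂(ℂ)` take the FLAT background `U = V = 1`
(curvature `ε = 0`, `plaqBg = 1`) and the coordinate `C = (tE₁₂, tE₂₁, tE₁₂, tE₂₁)`: BOTH covariant differences VANISH (a covariantly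
constant complex coordinate), yet the chart-point plaquette `e^{tE₁₂}e^{tE₂₁}e^{−tE₁₂}e^{−tE₂₁}` has `(holRel − 1)₂₂ = −t²` EXACTLY.  So
§3's quadratic member cannot be dropped: an amplitude-only relative ball of radius `ξα₁` around a configuration satisfying (1.11) contains
points whose plaquettes deviate by `≍ ξ²α₁²`, incompatible with (1.14)'s `α₀ξ²` unless `α₁² ≲ α₀` — false in print's regime
«B₃²O(1)Mα₀ < 1∕2α₁» (p. 277, after (3.37); v1.0.1 DOCFIX: `B₃²` re-read on the ×2 render, v1 carried `B₃`) for small `α₀`.  This is the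
kernel content of D-8-abs «relative ≠ absolute»; the relative set that DOES sit in clause (iii) is the weighted one of §4.
[cite: Balaban1987RG1, (1.13)-(1.14) p.262 and (3.43) p.278] -/
theorem flat_commutator_witness (t : ℂ) :
    covDiff₁ (1 : Fin 4 → Matrix (Fin 2) (Fin 2) ℂ) 1 ![nilUp t, nilDown t, nilUp t, nilDown t] = 0 ∧
      covDiff₂ (1 : Fin 4 → Matrix (Fin 2) (Fin 2) ℂ) 1 ![nilUp t, nilDown t, nilUp t, nilDown t] = 0 ∧
      plaqBg (1 : Fin 4 → Matrix (Fin 2) (Fin 2) ℂ) 1 = 1 ∧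
      (holRel (1 : Fin 4 → Matrix (Fin 2) (Fin 2) ℂ) 1 ![nilUp t, nilDown t, nilUp t, nilDown t] - 1) 1 1 = -(t ^ 2) := by
  refine ⟨by simp [covDiff₁], by simp [covDiff₂], by simp [plaqBg], ?_⟩
  rw [holRel_one_one]
  have h0 : (![nilUp t, nilDown t, nilUp t, nilDown t] : Fin 4 → Matrix (Fin 2) (Fin 2) ℂ) 0 = nilUp t := rfl
  have h1 : (![nilUp t, nilDown t, nilUp t, nilDown t] : Fin 4 → Matrix (Fin 2) (Fin 2) ℂ) 1 = nilDown t := rfl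
  have h2 : (![nilUp t, nilDown t, nilUp t, nilDown t] : Fin 4 → Matrix (Fin 2) (Fin 2) ℂ) 2 = nilUp t := rfl
  have h3 : (![nilUp t, nilDown t, nilUp t, nilDown t] : Fin 4 → Matrix (Fin 2) (Fin 2) ℂ) 3 = nilDown t := rfl
  rw [h0, h1, h2, h3, commutator_plaquette, Matrix.sub_apply]
  simp

end Witness

/-! ## §6 On the substrate's objects: the chart bond values, with unitarity discharging the side conditions -/

section Substrate

open scoped Matrix.Norms.L2Operator
open Summit.QuantumFields.BalabanUV.T4Continuum.SubstrateTransporterSpecies (expChart expChartInv expChart_apply expChartInv_apply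
  isUnit_det_of_mem_unitaryGroup)

variable {d : ℕ} {ι : Type*} {o : Type*} [Fintype o] [DecidableEq o]

/-- [folklore] **THE CHART-POINT PLAQUETTE IS `holRel` OF THE CHART'S BOND VALUES**: for four bonds `(νᵢ, bᵢ)` the word
`expChart R⁰ A ν₁ b₁ · expChart R⁰ A ν₂ b₂ · expChartInv R⁰ A ν₃ b₃ · expChartInv R⁰ A ν₄ b₄` is `holRel (R⁰ at the bonds) ((R⁰)⁻¹ at the
bonds) (A at the bonds)` — definitional bookkeeping, so §3–§4 apply to the substrate's chart of record verbatim. -/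
theorem holRel_eq_expChart (R₀ A : Fin d → (ι → Matrix o o ℂ)) (ν : Fin 4 → Fin d) (b : Fin 4 → ι) :
    holRel (fun i => R₀ (ν i) (b i)) (fun i => (R₀ (ν i) (b i))⁻¹) (fun i => A (ν i) (b i)) =
      expChart R₀ A (ν 0) (b 0) * expChart R₀ A (ν 1) (b 1) * expChartInv R₀ A (ν 2) (b 2) * expChartInv R₀ A (ν 3) (b 3) := by
  simp only [holRel, expChart_apply, expChartInv_apply]

variable [Nonempty o]

/-- **THE ESTIMATE ON THE SUBSTRATE'S CHART** (norm of record: `Matrix.Norms.L2Operator`).  For UNITARY-valued reference data `R⁰` the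
side conditions of `norm_holRel_sub_one_le` hold at any four bonds (`‖R⁰‖ = ‖(R⁰)⁻¹‖ = 1`, two-sided inverses), so the plaquette word of
the chart point `expChart R⁰ A` obeys `‖… − 1‖ ≤ ε + 2δ + 4aε + (e^{4a} − 1 − 4a)` with `ε` the reference plaquette's deviation, `a` the
amplitude of `A` and `δ` the two covariant differences at those bonds. [cite: Balaban1987RG1, (1.11)-(1.14) p.262 and (3.43) p.278] -/
theorem norm_chartPlaquette_sub_one_le {R₀ : Fin d → (ι → Matrix o o ℂ)} (hR : ∀ ν i, R₀ ν i ∈ Matrix.unitaryGroup o ℂ)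
    (A : Fin d → (ι → Matrix o o ℂ)) (ν : Fin 4 → Fin d) (b : Fin 4 → ι) {a δ ε : ℝ}
    (hC : ∀ i, ‖A (ν i) (b i)‖ ≤ a)
    (hD₁ : ‖covDiff₁ (fun i => R₀ (ν i) (b i)) (fun i => (R₀ (ν i) (b i))⁻¹) (fun i => A (ν i) (b i))‖ ≤ δ)
    (hD₂ : ‖covDiff₂ (fun i => R₀ (ν i) (b i)) (fun i => (R₀ (ν i) (b i))⁻¹) (fun i => A (ν i) (b i))‖ ≤ δ)
    (hP : ‖plaqBg (fun i => R₀ (ν i) (b i)) (fun i => (R₀ (ν i) (b i))⁻¹) - 1‖ ≤ ε) :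
    ‖expChart R₀ A (ν 0) (b 0) * expChart R₀ A (ν 1) (b 1) * expChartInv R₀ A (ν 2) (b 2) * expChartInv R₀ A (ν 3) (b 3) - 1‖ ≤
      ε + (2 * δ + 4 * a * ε + (Real.exp (4 * a) - 1 - 4 * a)) := by
  rw [← holRel_eq_expChart]
  have hmem : ∀ i, R₀ (ν i) (b i) ∈ Matrix.unitaryGroup o ℂ := fun i => hR _ _
  have hinvmem : ∀ i, (R₀ (ν i) (b i))⁻¹ ∈ Matrix.unitaryGroup o ℂ := fun i => by
    have h := hmem i
    have hstar : star (R₀ (ν i) (b i)) * R₀ (ν i) (b i) = 1 := Matrix.mem_unitaryGroup_iff'.1 h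
    rw [Matrix.inv_eq_left_inv hstar]
    exact Unitary.star_mem h
  refine norm_holRel_sub_one_le (fun i => ?_) (fun i => ?_) (fun i => ?_) (fun i => ?_) hC hD₁ hD₂ hP
  · exact (CStarRing.norm_of_mem_unitary (hmem i)).le
  · exact (CStarRing.norm_of_mem_unitary (hinvmem i)).le
  · exact Matrix.mul_nonsing_inv _ (isUnit_det_of_mem_unitaryGroup (hmem i))
  · exact Matrix.nonsing_inv_mul _ (isUnit_det_of_mem_unitaryGroup (hmem i))

end Substrate

end Summit.QuantumFields.BalabanUV.T4Continuum.NE9RelativeChartPlaquetteWitness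

end
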